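import Summits.CriticalPhenomena.PercolationContinuityZ3.Theorems.Transplant.KNLevelsStepII
import Summits.CriticalPhenomena.PercolationContinuityZ3.Theorems.Transplant.KNLevelsStepIII
import HarnessLib

/-!
# F7 (generic), the SEED LEMMA — Kozma–Nitzan's Lemma 10 stopped after Step III: from `P_W(o ↔ B) > 1 − δ` to an OPEN SEED at a selected
# contact of some level of the window, with probability `> 1 − 3δ` (Steps II + III, no gluing, no Step IV/V; constants explicit)

builds on p205010 (kernel theorem, internal audit signed; external expert review pending) — nothing in this file uses p205010.
Lane `prim-bschramm`, seat `prim-bschramm-stmt` (gen 3; p2-g2's v3 design EDGE-CONTACTS.md §5 names this `seed_of_kits`: the hand-over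
object between generations is an open seed cube located from the probe's own pattern); helper file (`--supports stmt-CriticalPhenomena-4575`).

* **`LHyp.seedLemma_of_kits`** — level datum `L` with `LHyp L W p D R`, degrees `≤ Δ`, `p < 1`; a window `[j₀, j₁] ⊆ [0, R]` with
  `(1−p)^{−ΔN} ≤ δ · #[j₀, j₁]`; per level a seed kit `σ j` (`SHyp L j (σ j)`, `(σ j).N ≤ N`, `(1 − p^{sB})^k ≤ δ`); then
  `1 − δ < P_W(o ↔ X 0)` gives a level `j` of the window with `1 − 3δ < P_W(Gev (σ j) j)` — the event that a SELECTED contact vertex `x ∈ (σ j).K`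
  of level `j` has all its seed edges open (`LData.Gev`; on it `o ↔ u` for every `u ∈ (σ j).face x`, `openConn_of_mem_oSeed`).
* `seedLemma_of_kits'` — the same with the conclusion spelled as `∃ x ∈ (σ j).K, ω ∈ L.oSeed (σ j) j x`.
No `ε/δ_{C3}` bookkeeping: `δ` is free, the graph enters only through Step II's degree count (so the statement is uniform in `G` as it stands).
[cite: KozmaNitzan2024, §4 Lemma 10, Steps II–III (pp. 18–19, (19))] [cite: GrimmettPercolation1999, §7.2]
-/

noncomputable section

open MeasureTheory ProbabilityTheory

namespace Summit.CriticalPhenomena.PercolationContinuityZ3.Theorems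

namespace Transplant

namespace KNLevels

open Literature.Probability.Percolation Literature.Probability.LatticeModels SimpleGraph

variable {V : Type*} [DecidableEq V] {G : SimpleGraph V} [G.LocallyFinite]

namespace LHyp

variable {L : LData G} {W : Sym2 V → unitInterval} {p : unitInterval} {D : Finset V} {R : ℕ}
variable (hL : LHyp L W p D R)
include hL

/-- **The seed lemma** (Lemma 10, Steps II + III): under `LHyp`, degrees `≤ Δ`, `p < 1`, a window `[j₀, j₁] ⊆ [0, R]` with
`(1−p)^{−ΔN} ≤ δ · #[j₀, j₁]` and per-level seed kits `σ j` (`SHyp`, `N_σ ≤ N`, `(1 − p^{sB})^k ≤ δ`): if `1 − δ < P_W(o ↔ X 0)` then at some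
level `j` of the window a selected contact vertex has an open seed with probability `> 1 − 3δ`.
[cite: KozmaNitzan2024, §4 Lemma 10, Steps II–III (pp. 18–19)] -/
theorem seedLemma_of_kits [Countable V] {Δ : ℕ} (hΔ : ∀ x, G.degree x ≤ Δ) (hp1 : (p : ℝ) < 1) {N j₀ j₁ : ℕ} (hj₁ : j₁ ≤ R) {δ : ℝ}
    (hJ : 1 / (1 - (p : ℝ)) ^ (Δ * N) ≤ δ * ((Finset.Icc j₀ j₁).card : ℝ)) (σ : ℕ → SData V)
    (hkits : ∀ j ∈ Finset.Icc j₀ j₁, SHyp L j (σ j) ∧ (σ j).N ≤ N ∧ (1 - (p : ℝ) ^ (σ j).sB) ^ (σ j).k ≤ δ)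
    (hreach : 1 - δ < (prodBernoulli W).real L.reachB) :
    ∃ j ∈ Finset.Icc j₀ j₁, 1 - 3 * δ < (prodBernoulli W).real (L.Gev (σ j) j) := by
  -- Step II: a level with many contacts
  obtain ⟨j, hjJ, hII⟩ := hL.stepII hΔ hp1 (N := N) hj₁ hJ hreach
  have hjR : j ≤ R := (Finset.mem_Icc.1 hjJ).2.trans hj₁
  obtain ⟨hσ, hN, hIII⟩ := hkits j hjJ
  refine ⟨j, hjJ, ?_⟩
  set μ := prodBernoulli W with hμ
  -- many contacts for `σ j`'s own threshold
  have hsub : {ω : BondConfig V | N ≤ (L.Kont j ω).card} ⊆ (L.Fail (σ j).N j)ᶜ := by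
    intro ω hω
    simp only [Set.mem_compl_iff, LData.Fail, Set.mem_setOf_eq, not_lt]
    exact hN.trans hω
  have h1 : 1 - 2 * δ < μ.real (L.Fail (σ j).N j)ᶜ := hII.trans_le (measureReal_mono hsub (measure_ne_top _ _))
  -- Step III, (19)
  have h2 : μ.real ((L.Fail (σ j).N j)ᶜ \ L.Gev (σ j) j) ≤ δ := (hL.real_manyContacts_diff_Gev_le hσ hjR).trans hIII
  -- inclusion–exclusion
  have h3 : μ.real (L.Fail (σ j).N j)ᶜ ≤ μ.real (L.Gev (σ j) j) + μ.real ((L.Fail (σ j).N j)ᶜ \ L.Gev (σ j) j) := by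
    refine le_trans (measureReal_mono ?_ (measure_ne_top _ _)) (measureReal_union_le _ _)
    intro ω hω
    by_cases hG : ω ∈ L.Gev (σ j) j
    · exact Or.inl hG
    · exact Or.inr ⟨hω, hG⟩
  linarith

/-- The seed lemma with the conclusion unpacked: some selected contact vertex `x ∈ (σ j).K` with an open seed.
[cite: KozmaNitzan2024, §4 Lemma 10, Steps II–III (pp. 18–19)] -/
theorem seedLemma_of_kits' [Countable V] {Δ : ℕ} (hΔ : ∀ x, G.degree x ≤ Δ) (hp1 : (p : ℝ) < 1) {N j₀ j₁ : ℕ} (hj₁ : j₁ ≤ R) {δ : ℝ}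
    (hJ : 1 / (1 - (p : ℝ)) ^ (Δ * N) ≤ δ * ((Finset.Icc j₀ j₁).card : ℝ)) (σ : ℕ → SData V)
    (hkits : ∀ j ∈ Finset.Icc j₀ j₁, SHyp L j (σ j) ∧ (σ j).N ≤ N ∧ (1 - (p : ℝ) ^ (σ j).sB) ^ (σ j).k ≤ δ)
    (hreach : 1 - δ < (prodBernoulli W).real L.reachB) :
    ∃ j ∈ Finset.Icc j₀ j₁, 1 - 3 * δ < (prodBernoulli W).real {ω | ∃ x ∈ (σ j).K, ω ∈ L.oSeed (σ j) j x} := by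
  obtain ⟨j, hjJ, h⟩ := hL.seedLemma_of_kits hΔ hp1 hj₁ hJ σ hkits hreach
  refine ⟨j, hjJ, h.trans_le (measureReal_mono (fun ω hω => ?_) (measure_ne_top _ _))⟩
  exact LData.mem_Gev_iff.1 hω

end LHyp

end KNLevels

end Transplant

end Summit.CriticalPhenomena.PercolationContinuityZ3.Theorems

end
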